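import Summits.QuantumFields.BalabanUV.T4Continuum.Spine.NE1p.DressedStabilityOfSuppliedSchedules
import Summits.QuantumFields.BalabanUV.T4Continuum.Spine.NE1p.DressedBirthRStepAnchored
import Summits.QuantumFields.BalabanUV.T4Continuum.Spine.NE1p.DressedCellNecessity
import Summits.QuantumFields.BalabanUV.T4Continuum.Spine.NE1p.DressedAbsorptionWitness

/-!
# T⁴ programme, spine estimate NE1′ (node O3b/H2) — NON-VACUITY OF THE «END-ALL ∘ SUPPLIERS» DATA AT ROW S3's CELL WITH AN INTEGER
# BLOCKING FACTOR: anchoring on `ℕ⁴` with `L = 21`, an ℝ-step datum with genuine absorption, ONE K-free scalar set, the ROOT through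
# END-B at every cutoff (swarm witness «W8» of `t4/formal/NE1p/LEAVES.md`, INTENT HOME/CLAIMS.log l.10775) [decided toy]

Cell `pub-balaban`, sub-cell `t4`, BINDER-OWNERS row NE1′ (owner lineage t4-ne1p-p1); swarm unit `b2b-balaban-t4-ne1p-formalise-leaf-02`
(gen 2); tree target `Summits/QuantumFields/BalabanUV/T4Continuum/Spine/NE1p/`; ADDITIVE — imports the crew's landed
`Spine/NE1p/DressedStabilityOfSuppliedSchedules` (row S3i p214477: `count_of_anchoring_cell`, `positionalCount_of_anchoring_cell`; through
it rows S3∕S4∕S5b and the root), `Spine/NE1p/DressedBirthRStepAnchored` (row S5e p214587: `hbirth_of_rstep_cell`) and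
`Spine/NE1p/DressedCellNecessity` (row S3c p213339: `exp_three_gt_20_08`), and my gen-1 witness `Spine/NE1p/DressedAbsorptionWitness` (row W3
p213076: the birth-scale dictionary `bs`∕`bs_le`∕`bs_false`∕`bs_true` reused BY NAME) ONLY; modifies nothing.

WHY.  Rows S3i ∕ S3j ∕ S5e replaced the END-ALL's structural binders by DATA SHAPES — a block-lattice `Anchoring (𝒯.B a K) 4 Lb` whose
blocking INTEGER is the cell's `L` (`(Lb:ℝ) = L`: the count rate `Λ = L⁴` of `uniformConstantsCell` IS the anchoring's), met components
housing the live families (`v`, `mB`, `v·mB ≤ N₀`), row O3.E-iii-c's `RStep` datum (`absorbs`, `absorbs_felt`, `CompVol vR`, `PreBelowEnv`,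
`AbsorbLaw`) with the fan-out pair at `vR·mB` — next to row S3's located largeness and (w6) window ON THE SAME `L`.  This file decides,
on a toy, that these shapes are JOINTLY INHABITABLE at an INTEGER `L`: §1 the toy (two families, old born at `0`, young at `1` ABSORBING
the old one through `w8RStep` — `PreBelowEnv`∕`AbsorbLaw` as EQUALITIES —, one cube per scale, the anchoring `w8Anchoring K : Anchoring _ 4 21`
at the zero block, sizes in the cell's class at rate `ρ = 21⁻²·e³`, decay `τ = 21⁻³`); §2 the ONE scalar set `(L, C, c̄, κ, N₀, A₀, m, s̄⁰,
ρ′) = (21, 1, 0, 0, 2, 2, 1∕336, 1∕2, 41∕42)` (`locCell 21 1 0 0 = e³∕21 ≤ 41∕42` by `exp_three_lt`; `fanout (1∕168) 2 (41∕42) = 1∕2`;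
`absorbAmplitude 1 (1∕168) 2 (41∕42) = 2`) and `twenty_blocks_excluded` (`e³ > 20.08`: no `ρ′ < 1` admits `L = 20` — `21` is the least
admissible blocking integer at `κ = 0`); §3 `w8Leaves K` by `bookingLeavesCell` with `hS`∕`hcount` FROM `count_of_anchoring_cell` and
**`hbirth` FROM `hbirth_of_rstep_cell`**, `dressedStability_w8Tower : DressedStability w8Tower` through END-B `dressedStability_of_cell` with
the ONE cell at EVERY cutoff, the With-form, ROOT-B `dressedBudget_w8Tower` (counts by `positionalCount_of_anchoring_cell`), and
`absorption_genuine` (birth generation STRICTLY above the dressing).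

HONEST FRAMING.  A DECIDED TOY: booking-level joint inhabitation of hypothesis SHAPES; the function-level END faces are NOT exercised
here (rows W2∕W5∕W7 do that); NOTHING of Bałaban's densities, components, D-terms or windows is modelled or asserted; `21` is the toy's
integer, a kernel CONSEQUENCE of `locCell`, never «Bałaban's L» (caveat k2).  [folklore] 0 sorry; 0 citations; no `def … : Prop` (the
`def`s are toy DATA).  Headline: «the anchoring ∕ ℝ-seam data shapes of S3i∕S3j are jointly inhabitable with row S3's cell at an integer
blocking factor — nothing of NE1′'s estimate content»; NE1′ NOT proved; 0 binders instantiated on Bałaban's densities; spine PROVED 0∕9.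
Rung (B)+1 on ONE finite four-torus — NOT infinite volume, NOT a mass gap, NOT the Clay problem.  HONEST DEPENDENCY: continuum YM on T⁴ ⇐
BetaPertH ∧ nine spine estimates (0/9 proved); BetaPertH ⇐ (D1) ∧ (D4) ∧ CAP+tail; G-an2-4 gates asym, D1 and NE2/3/4.
-/

noncomputable section

namespace Summit.QuantumFields.BalabanUV.T4Continuum.NE1p.DressedSuppliedWitness

open Finset
open scoped BigOperators
open Literature.MathematicalPhysics.QuantumFieldTheory.Balaban1983to89
open Literature.MathematicalPhysics.QuantumFieldTheory.Balaban1983to89.T4TermFormat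
open Literature.MathematicalPhysics.QuantumFieldTheory.Balaban1983to89.T4TermFormat.Booking
open Literature.MathematicalPhysics.QuantumFieldTheory.Balaban1983to89.T4FeltGeometry
open Literature.MathematicalPhysics.QuantumFieldTheory.Balaban1983to89.T4TrajectoryComparison
open Literature.MathematicalPhysics.QuantumFieldTheory.Balaban1983to89.T4PreservedUnderR (RStep)
open Summit.QuantumFields.BalabanUV.T4Continuum.T4TrajectoryDensityDressed
open Summit.QuantumFields.BalabanUV.T4Continuum.NE1p.DressedRoot
open Summit.QuantumFields.BalabanUV.T4Continuum.NE1p.DressedUniformConstants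
open Summit.QuantumFields.BalabanUV.T4Continuum.NE1p.DressedAbsorptionWindow
open Summit.QuantumFields.BalabanUV.T4Continuum.NE1p.DressedPositionalCount
open Summit.QuantumFields.BalabanUV.T4Continuum.NE1p.DressedStabilityOfSuppliedSchedules
open Summit.QuantumFields.BalabanUV.T4Continuum.NE1p.DressedBirthRStepAnchored
open Summit.QuantumFields.BalabanUV.T4Continuum.NE1p.DressedCellNecessity
open Summit.QuantumFields.BalabanUV.T4Continuum.NE1p.DressedAbsorptionWitness (bs bs_le bs_false bs_true)

/-! ## §1 The toy: two families, one cube per scale, the cell's rates at `L = 21`, anchoring and ℝ-step data -/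

section Toy

-- Birth scales `bs K b` (old family `false` at `0`, young `true` at `min 1 K`) and `bs_le`∕`bs_false`∕`bs_true` are row W3's, BY NAME.

/-- The cell's transport rate at `L = 21`, `κ = 0`: `ρ = 21⁻²·e³` [decided toy]. [folklore] -/
abbrev rW : ℝ := ((21 : ℝ) ^ 2)⁻¹ * alphaCell 0

/-- The cell's source decay at `L = 21`: `τ = 21⁻³` [decided toy]. [folklore] -/
abbrev tW : ℝ := (21 : ℝ)⁻¹ ^ 3

/-- The absorption constant [decided toy]: `A = 1∕168` (fan-out `A·(vR·mB)·(1−ρ′)⁻¹ = (1∕168)·2·42 = 1∕2`). [folklore] -/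
abbrev AW : ℝ := 1 / 168

/-- `ρ > 0`. [folklore] -/ theorem rW_pos : 0 < rW := mul_pos (by positivity) (alphaCell_pos le_rfl)
/-- `τ > 0`. [folklore] -/ theorem tW_pos : 0 < tW := by positivity

/-- Birth generations [decided toy]: the dressing `τ^{K−j_b}` plus, for the young family when it is genuinely younger, `A·ρ·τ^K` —
`A ×` the old family's size just before the ℝ-operation of scale `1`. [folklore] -/
def gW (K : ℕ) (b : Bool) : ℝ := tW ^ (K - bs K b) + if b = true ∧ 1 ≤ K then AW * rW * tW ^ K else 0

/-- Birth generations are positive. [folklore] -/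
theorem gW_pos (K : ℕ) (b : Bool) : 0 < gW K b := by
  unfold gW
  have h1 : 0 < tW ^ (K - bs K b) := pow_pos tW_pos _
  have h2 : 0 ≤ (if b = true ∧ 1 ≤ K then AW * rW * tW ^ K else 0) := by
    split_ifs
    · exact mul_nonneg (mul_nonneg (by norm_num) rW_pos.le) (pow_nonneg tW_pos.le _)
    · exact le_rfl
  linarith

/-- TOY BOOKING at cutoff `K` [decided toy]: two families (`Bool`), one cube per scale `0…K`, every family felt at every cube from
its birth on, POSITIVE booked size `gW K b·ρ^{k−j_b}` at scale `k`.  Nothing of Bałaban's is modelled. [folklore] -/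
def w8Booking (K : ℕ) : T4TermFormat.Booking where
  K := K
  Dom := Bool
  domScale := bs K
  treeLen := fun _ => 0
  treeLen_nonneg := fun _ => le_rfl
  balSize := fun _ => 0
  Birth := Bool
  births := Finset.univ
  mem_births := fun b => Finset.mem_univ b
  birthScale := bs K
  birth_le := bs_le K
  loc := id
  loc_scale := fun _ => rfl
  Cube := Fin (K + 1)
  cubes := Finset.univ
  mem_cubes := fun q => Finset.mem_univ q
  cubeScale := fun q => q.val
  cube_le := fun q => Nat.lt_succ_iff.mp q.isLt
  feltAt := fun q => Finset.univ.filter fun b => bs K b ≤ q.val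
  felt_birth_le := fun q b hb => (Finset.mem_filter.mp hb).2
  size := fun b k => gW K b * rW ^ (k - bs K b)
  size_nonneg := fun b k => by have := gW_pos K b; have := rW_pos; positivity
  pair := fun _ _ _ => 0

/-- TOY TRAJECTORY [decided toy]: one generation per family (its birth), re-linearised size = the birth generation transported at
the cell's rate `ρ`. [folklore] -/
def w8Trajectory (K : ℕ) : Trajectory (w8Booking K) where
  lin := fun b k' k => if k' = bs K b then gW K b * rW ^ (k - bs K b) else 0
  lin_nonneg := fun b k' k => by have := gW_pos K b; have := rW_pos; split_ifs <;> positivity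
  gen := fun b k' => if k' = bs K b then gW K b else 0
  gen_nonneg := fun b k' => by have := gW_pos K b; split_ifs <;> positivity
  size_le := fun b k hbk _ => by
    show gW K b * rW ^ (k - bs K b) ≤
      ∑ k' ∈ Icc (bs K b) k, (if k' = bs K b then gW K b * rW ^ (k - bs K b) else 0)
    rw [Finset.sum_ite_eq' (Icc (bs K b) k) (bs K b) (fun _ => gW K b * rW ^ (k - bs K b))]
    have hbk' : bs K b ≤ k := hbk
    rw [if_pos (Finset.mem_Icc.mpr ⟨le_rfl, hbk'⟩)]

/-- TOY TOWER [decided toy]: the two-family booking and trajectory at every cutoff (one run parameter). [folklore] -/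
def w8Tower : DressedTower Unit where
  B := fun _ K => w8Booking K
  K_eq := fun _ _ => rfl
  T := fun _ K => w8Trajectory K

/-- THE ANCHORING ON `ℕ⁴` WITH BLOCKING INTEGER `21` [decided toy]: every localisation domain is the zero block of its scale, every
cube is centred at the zero block — which coarsens to itself under any number of `21`-fold blockings. [folklore] -/
def w8Anchoring (K : ℕ) : Anchoring (w8Booking K) 4 21 where
  dom := fun _ => {0}
  center := fun _ => 0
  felt_under := fun _ _ _ => ⟨0, Finset.mem_singleton_self _, by funext i; simp [coarsen]⟩

/-- Per-block multiplicity `mB = 2`: at most the two families have a given block in their domain. [folklore] -/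
theorem w8_hmult (K : ℕ) : ∀ j (x : Fin 4 → ℕ),
    ((w8Booking K).births.filter fun b => (w8Booking K).birthScale b = j ∧ x ∈ (w8Anchoring K).dom b).card ≤ 2 := by
  intro j x
  show ((Finset.univ : Finset Bool).filter fun b => bs K b = j ∧ x ∈ ({0} : Finset (Fin 4 → ℕ))).card ≤ 2
  exact (card_le_card (filter_subset _ _)).trans (by simp)

/-- Met components [decided toy]: the one cube of the current scale (none above the cutoff). [folklore] -/
def w8Comp (K : ℕ) (k : ℕ) (_b : Bool) : Finset (Fin (K + 1)) :=
  if h : k ≤ K then {⟨k, Nat.lt_succ_of_le h⟩} else ∅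

/-- The component's cubes have the current scale. [folklore] -/
theorem w8_hscale (K : ℕ) : ∀ k b, ∀ q ∈ w8Comp K k b, (w8Booking K).cubeScale q = k := by
  intro k b q hq
  unfold w8Comp at hq
  split_ifs at hq with h
  · rw [Finset.mem_singleton] at hq
    subst hq
    rfl
  · simp at hq

/-- Component volume `v = 1`. [folklore] -/
theorem w8_hvol (K : ℕ) : ∀ k b, (w8Comp K k b).card ≤ 1 := by
  intro k b; unfold w8Comp; split_ifs <;> simp

/-- Live families of a met component [decided toy]: every family born at a scale `≤ k`, none booked above the cutoff. [folklore] -/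
def w8S (K : ℕ) (k : ℕ) (_b : Bool) : Finset Bool := Finset.univ.filter fun f => bs K f ≤ k ∧ k ≤ K

/-- Live families are housed: each is felt at the component's cube. [folklore] -/
theorem w8_hhoused (K : ℕ) : ∀ k b, ∀ f ∈ w8S K k b, ∃ q ∈ w8Comp K k b, f ∈ (w8Booking K).feltAt q := by
  intro k b f hf
  obtain ⟨hfk, hkK⟩ := (Finset.mem_filter.mp hf).2
  refine ⟨⟨k, Nat.lt_succ_of_le hkK⟩, ?_, ?_⟩
  · unfold w8Comp
    rw [dif_pos hkK]
    exact Finset.mem_singleton_self _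
  · exact Finset.mem_filter.mpr ⟨Finset.mem_univ _, hfk⟩

/-- The absorbed families [decided toy]: the young family absorbs the old one when it is genuinely younger (`K ≥ 1`). [folklore] -/
def w8Sabs (K : ℕ) (b : Bool) : Finset Bool := if b = true ∧ 1 ≤ K then {false} else ∅

/-- Absorbed families are strictly older. [folklore] -/
theorem w8Sabs_lt (K : ℕ) : ∀ b b₀ : Bool, b₀ ∈ w8Sabs K b → bs K b₀ < bs K b := by
  intro b b₀ h
  unfold w8Sabs at h
  split_ifs at h with hb
  · rw [Finset.mem_singleton] at h
    subst h
    rw [hb.1, bs_false, bs_true hb.2]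
    exact Nat.zero_lt_one
  · simp at h

/-- THE ℝ-STEP DATUM [decided toy]: pre-ℝ sizes = the transported sizes, the young family absorbs the old one, the renormalised
component of a birth is the one cube of its birth scale (so an absorbed family IS felt there), dressing sizes `τ^{K−j}`. [folklore] -/
def w8RStep (K : ℕ) : RStep (w8Booking K) where
  pre := fun b k => gW K b * rW ^ (k - bs K b)
  pre_nonneg := fun b k => by have := gW_pos K b; have := rW_pos; positivity
  absorbs := w8Sabs K
  absorbs_lt := w8Sabs_lt K
  comp := fun b' => {⟨bs K b', Nat.lt_succ_of_le (bs_le K b')⟩}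
  comp_scale := fun b' q hq => by
    rw [Finset.mem_singleton] at hq
    subst hq; rfl
  absorbs_felt := fun b' b hb => by
    refine ⟨⟨bs K b', Nat.lt_succ_of_le (bs_le K b')⟩, Finset.mem_singleton_self _, ?_⟩
    exact Finset.mem_filter.mpr ⟨Finset.mem_univ (α := Bool) b, (w8Sabs_lt K b' b hb).le⟩
  δ := fun b' => tW ^ (K - bs K b')
  δ_nonneg := fun _ => pow_nonneg tW_pos.le _

/-- Component volume of the ℝ-step: `vR = 1`. [folklore] -/
theorem w8_compVol (K : ℕ) : (w8RStep K).CompVol 1 := fun b' => by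
  show (({(⟨bs K b', Nat.lt_succ_of_le (bs_le K b')⟩ : Fin (K + 1))} : Finset (Fin (K + 1))).card) ≤ 1
  rw [Finset.card_singleton]

/-- The transport-rate step product of the toy: `stepProd (fun _ => ρ) k′ k = ρ^{k−k′}`. [arith] [folklore] -/
theorem stepProd_rW (k' k : ℕ) : stepProd (fun _ : ℕ => ((21 : ℝ) ^ 2)⁻¹ * alphaCell 0) k' k = rW ^ (k - k') :=
  stepProd_const _ _ _

/-- The transported envelope of a toy family is its single birth generation transported: `envVar 1 ρ b k = ρ^{k−j_b}·gW K b`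
(`k ≥ j_b`). [arith] [folklore] -/
theorem envVar_w8 (K : ℕ) (b : Bool) {k : ℕ} (hk : bs K b ≤ k) :
    (w8Trajectory K).envVar 1 (fun _ : ℕ => ((21 : ℝ) ^ 2)⁻¹ * alphaCell 0) b k = rW ^ (k - bs K b) * gW K b := by
  show ∑ k' ∈ Icc (bs K b) k, (1 : ℝ) * stepProd (fun _ : ℕ => ((21 : ℝ) ^ 2)⁻¹ * alphaCell 0) k' k *
      (if k' = bs K b then gW K b else 0) = rW ^ (k - bs K b) * gW K b
  have hterm : ∀ k' ∈ Icc (bs K b) k, (1 : ℝ) * stepProd (fun _ : ℕ => ((21 : ℝ) ^ 2)⁻¹ * alphaCell 0) k' k *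
      (if k' = bs K b then gW K b else 0) = if k' = bs K b then rW ^ (k - bs K b) * gW K b else 0 := by
    intro k' _
    split_ifs with h
    · subst h; rw [stepProd_rW, one_mul]
    · rw [mul_zero]
  rw [Finset.sum_congr rfl hterm, Finset.sum_ite_eq' (Icc (bs K b) k) (bs K b)]
  rw [if_pos (Finset.mem_Icc.mpr ⟨le_rfl, hk⟩)]

/-- **`PreBelowEnv` HOLDS (with equality)** [decided toy]: the size just before the ℝ-operation of scale `k+1` is the rate times the
transported envelope at `k`. [folklore] -/
theorem w8_preBelowEnv (K : ℕ) (Gate : ℕ → Prop) :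
    (w8Trajectory K).PreBelowEnv (w8RStep K) 1 (fun _ : ℕ => ((21 : ℝ) ^ 2)⁻¹ * alphaCell 0) Gate := by
  intro b k hbk _ _
  have hbk' : bs K b ≤ k := hbk
  show gW K b * rW ^ (k + 1 - bs K b) ≤ (((21 : ℝ) ^ 2)⁻¹ * alphaCell 0) *
    (w8Trajectory K).envVar 1 (fun _ : ℕ => ((21 : ℝ) ^ 2)⁻¹ * alphaCell 0) b k
  rw [envVar_w8 K b hbk', Nat.sub_add_comm hbk', pow_succ]
  exact le_of_eq (by ring)

/-- **`AbsorbLaw` HOLDS (with equality for the young family)** [decided toy]: birth generation = dressing `τ^{K−j}` `+ A ×` the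
absorbed old family's pre-ℝ size at the young birth scale. [folklore] -/
theorem w8_absorbLaw (K : ℕ) : (w8Trajectory K).AbsorbLaw (w8RStep K) 1 (fun j => tW ^ (K - j)) AW := by
  intro b
  change Bool at b
  show (1 : ℝ) * (if bs K b = bs K b then gW K b else 0) ≤
    tW ^ (K - bs K b) + AW * ∑ b₀ ∈ w8Sabs K b, gW K b₀ * rW ^ (bs K b - bs K b₀)
  rw [if_pos rfl, one_mul]
  unfold gW w8Sabs
  by_cases hb : b = true ∧ 1 ≤ K
  · rw [if_pos hb, if_pos hb, Finset.sum_singleton, hb.1, bs_true hb.2, bs_false]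
    have hold : ¬ (false = true ∧ 1 ≤ K) := by simp
    rw [if_neg hold, add_zero, Nat.sub_zero, Nat.sub_zero, pow_one]
    exact le_of_eq (by ring)
  · rw [if_neg hb, if_neg hb, add_zero, Finset.sum_empty, mul_zero, add_zero]

/-- **THE ABSORPTION IS GENUINE** [decided toy]: for `K ≥ 1` the young family's birth generation STRICTLY exceeds its own dressing
`τ^{K−1}` — the absorbed pre-ℝ size `A·ρ·τ^K > 0` is really spent. [folklore] -/
theorem absorption_genuine {K : ℕ} (hK : 1 ≤ K) : (w8RStep K).δ true < (w8Trajectory K).gen true (bs K true) := by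
  show tW ^ (K - bs K true) < if bs K true = bs K true then gW K true else 0
  rw [if_pos rfl]
  unfold gW
  rw [if_pos ⟨rfl, hK⟩]
  have : 0 < AW * rW * tW ^ K := mul_pos (mul_pos (by norm_num) rW_pos) (pow_pos tW_pos _)
  linarith

end Toy

/-! ## §2 The ONE scalar set: located largeness at the integer `L = 21`, (w6) window, anchoring and fan-out numbers -/

section Scalars

/-- `1 ≤ 21`. [folklore] -/ theorem hL21 : (1 : ℝ) ≤ 21 := by norm_num

/-- **THE LOCATED LARGENESS AT THE INTEGER `L = 21`** [decided toy]: `locCell 21 1 0 0 = e³∕21 ≤ 41∕42` (`e³ < 20.5`,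
`DressedUniformConstants.exp_three_lt`). [folklore] -/
theorem hloc21 : locCell 21 1 0 0 ≤ 41 / 42 := by
  unfold locCell alphaCell
  have h := exp_three_lt
  have : Real.exp 3 * (1 + 4 * 0) / 21 + 21 * 1 * 0 = Real.exp 3 / 21 := by ring
  rw [this, div_le_iff₀ (by norm_num : (0 : ℝ) < 21)]
  linarith

/-- **TWENTY BLOCKS PER SIDE ARE EXCLUDED** [decided toy]: NO `ρ′ < 1` admits `locCell 20 C c̄ κ ≤ ρ′` for any signs-admissible
`C, c̄, κ` (`e³ > 20.08`, row S3c) — `21` is the least blocking integer the located largeness admits. [folklore] -/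
theorem twenty_blocks_excluded {C cbar κ ρ' : ℝ} (hC : 0 ≤ C) (hcbar : 0 ≤ cbar) (hκ : 0 ≤ κ) (hρ' : ρ' < 1) :
    ¬ locCell 20 C cbar κ ≤ ρ' := by
  intro h
  unfold locCell alphaCell at h
  have h3 := exp_three_gt_20_08
  have hpos : 0 ≤ 20 * C * cbar := by positivity
  have hexp : Real.exp 3 ≤ Real.exp 3 * (1 + 4 * κ) := le_mul_of_one_le_right (Real.exp_pos 3).le (by linarith)
  have : Real.exp 3 / 20 ≤ Real.exp 3 * (1 + 4 * κ) / 20 := div_le_div_of_nonneg_right hexp (by norm_num)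
  have : Real.exp 3 / 20 < 1 := by linarith
  rw [div_lt_one (by norm_num : (0 : ℝ) < 20)] at this
  linarith

/-- `41∕42 < 1`. [folklore] -/ theorem hρ'21 : (41 / 42 : ℝ) < 1 := by norm_num

/-- (w6) window: `m·(N₀A₀(1−ρ′)⁻¹) = (1∕336)·(2·2·42) = 1∕2 ≤ 1 − s̄⁰`. [folklore] -/
theorem hsmall21 : (1 / 336 : ℝ) * (2 * 2 * (1 - 41 / 42)⁻¹) ≤ 1 - 1 / 2 := by norm_num

/-- The cell's blocking integer IS the anchoring's: `((21 : ℕ) : ℝ) = 21`. [folklore] -/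
theorem hLb21 : ((21 : ℕ) : ℝ) = 21 := by norm_num
/-- `v·mB = 1·2 ≤ N₀ = 2`. [folklore] -/ theorem hvN₀21 : (((1 : ℕ) : ℝ)) * ((2 : ℕ) : ℝ) ≤ 2 := by norm_num

/-- Fan-out of the derived absorbed multiplicity `vR·mB = 2` below one: `(1∕168)·2·42 = 1∕2`. [folklore] -/
theorem hfan21 : fanout AW (((1 : ℕ) : ℝ) * ((2 : ℕ) : ℝ)) (41 / 42) < 1 := by
  norm_num [fanout]

/-- The absorption fixed point is the class amplitude: `absorbAmplitude 1 (1∕168) 2 (41∕42) = 2 ≤ A₀`. [folklore] -/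
theorem hamp21 : absorbAmplitude 1 AW (((1 : ℕ) : ℝ) * ((2 : ℕ) : ℝ)) (41 / 42) ≤ 2 := by
  norm_num [absorbAmplitude, fanout]

end Scalars

/-! ## §3 The leaves through the suppliers, and the root through END-B with the ONE cell at every cutoff -/

section Root

/-- **TOY LEAVES AT THE CELL — `hS`∕`hcount` BY `count_of_anchoring_cell`, `hbirth` BY `hbirth_of_rstep_cell`** [decided toy]: at
every cutoff the leaf bundle over `uniformConstantsCell 21 1 0 0 2 2 (1∕336) (1∕2) (41∕42)` (`bookingLeavesCell`: rates `21⁻²·e³`, no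
regeneration, action margins `0`), the (w3-book) fields read off the anchoring + housing, the birth leaf off the ℝ-step datum;
transport holds with equality at the birth generation, regeneration trivially (one generation per family). [folklore] -/
def w8Leaves (K : ℕ) :
    BookingLeaves (uniformConstantsCell 21 1 0 0 2 2 (1 / 336) (1 / 2) (41 / 42) hL21 zero_le_one le_rfl le_rfl (by norm_num)
      (by norm_num) (by norm_num) hloc21 hρ'21 hsmall21) (w8Booking K) (w8Trajectory K) :=
  bookingLeavesCell hL21 zero_le_one le_rfl le_rfl (by norm_num) (by norm_num) (by norm_num) hloc21 hρ'21 hsmall21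
    (fun _ => 0) (fun _ _ => 0) (w8S K) (fun _ => le_rfl) (fun _ _ => le_rfl)
    (count_of_anchoring_cell (w8Anchoring K) hLb21 hL21 (w8_hmult K) (w8_hscale K) (w8_hhoused K) (w8_hvol K) hvN₀21).1
    (count_of_anchoring_cell (w8Anchoring K) hLb21 hL21 (w8_hmult K) (w8_hscale K) (w8_hhoused K) (w8_hvol K) hvN₀21).2
    (fun _ _ => by norm_num)
    (hbirth_of_rstep_cell hL21 zero_le_one le_rfl le_rfl (by norm_num) (by norm_num) (by norm_num) hloc21 hρ'21 hsmall21
      (w8Trajectory K) (w8RStep K) (fun _ : ℕ => ((21 : ℝ) ^ 2)⁻¹ * alphaCell 0) (fun _ _ => 0) (w8S K) (w8Anchoring K)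
      hLb21 (w8_hmult K) (w8_compVol K) (by norm_num) (w8_preBelowEnv K _) (w8_absorbLaw K)
      (fun j _ => by rw [one_mul]; exact le_rfl) hfan21 hamp21)
    (fun b k' k _ _ _ _ => by
      show (if k' = bs K b then gW K b * rW ^ (k - bs K b) else 0) ≤
        1 * stepProd (fun _ : ℕ => ((21 : ℝ) ^ 2)⁻¹ * alphaCell 0) k' k * (if k' = bs K b then gW K b else 0)
      by_cases h : k' = bs K b
      · subst h
        rw [if_pos rfl, if_pos rfl, stepProd_rW]
        linarith
      · rw [if_neg h, if_neg h]
        simp)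
    (fun b k hbk _ _ => by
      show (if k + 1 = bs K b then gW K b else 0) ≤ 0 * (gW K b * rW ^ (k - bs K b))
      have hne : k + 1 ≠ bs K b := by
        have : bs K b ≤ k := hbk
        omega
      rw [if_neg hne]
      simp)

/-- **NON-VACUITY OF THE «END-ALL ∘ SUPPLIERS» DATA AT THE CELL** [decided toy]: the toy tower has `DressedStability` — END-B
`dressedStability_of_cell` with the ONE cell `uniformConstantsCell 21 …` serving every cutoff, its leaves supplied through
`count_of_anchoring_cell` (row S3i) and `hbirth_of_rstep_cell` (row S5e). [folklore] -/
theorem dressedStability_w8Tower : DressedStability w8Tower :=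
  dressedStability_of_cell w8Tower hL21 zero_le_one le_rfl le_rfl (by norm_num) (by norm_num) (by norm_num) hloc21 hρ'21
    hsmall21 fun _ K => w8Leaves K

/-- … with the constants displayed: class amplitude `2`, family factor `rhoOne 21⁻² 1 0 0 = 21⁻²·e³`, source decay `21⁻³`.
[folklore] -/
theorem dressedStabilityWith_w8Tower :
    DressedStabilityWith w8Tower 2 (rhoOne ((21 : ℝ) ^ 2)⁻¹ 1 0 0) ((21 : ℝ)⁻¹ ^ 3) :=
  dressedStabilityWith_of_bookingLeaves _ w8Tower fun _ K => w8Leaves K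

/-- **ROOT-B ON THE TOY, POSITIONAL COUNTS READ OFF THE ANCHORING** [decided toy]: with unit cube weights, the budget root
`DressedBudget w8Tower (fun _ _ _ => 1)` — `dressedBudget_of_dressedStabilityWith_strict` with the strict product = the located
largeness (`prod_cell`) and the bookings' counts `2·(21⁴)^{k−j}` by `positionalCount_of_anchoring_cell`. [folklore] -/
theorem dressedBudget_w8Tower : DressedBudget w8Tower (fun _ _ _ => 1) :=
  dressedBudget_of_dressedStabilityWith_strict (Λ := (21 : ℝ) ^ 4) (N₀ := 2) (r := 41 / 42) (wbar := 1)
    dressedStabilityWith_w8Tower (by norm_num) (by norm_num) (by rw [prod_cell (by norm_num)]; exact hloc21) hρ'21 zero_le_one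
    (fun _ _ _ _ => zero_le_one) (fun _ _ _ _ => le_rfl)
    fun _ K => positionalCount_of_anchoring_cell (w8Anchoring K) hLb21 hL21 (w8_hmult K) (by norm_num)

end Root

end Summit.QuantumFields.BalabanUV.T4Continuum.NE1p.DressedSuppliedWitness

end
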